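import Summits.AtomisticToContinuum.HydrodynamicLimit.Theses.UGibbsSRBRigidity
import Summits.AtomisticToContinuum.HydrodynamicLimit.Theses.JParityClosure
import Summits.AtomisticToContinuum.HydrodynamicLimit.Theorems.JParityClosureOddContactSymmetryCollisionWindows
import Literature.MathematicalPhysics.KineticTheory.HardSphereEulerProofs
import HarnessLib

/-!
# `UGibbsSRBRigidity.CollisionMoments` (stmt-AtomisticToContinuum-9393) implies
# `JParityClosure.CollisionTightness` (stmt-AtomisticToContinuum-13085): the bookkeeping bridge

Helper file (`--supports stmt-AtomisticToContinuum-9393`).  The support item `CollisionMoments` of route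
`UGibbsSRBRigidity` asks, for every continuous local-Gibbs profile `(a₀, u₀, θ₀)`, small reduced diameter
`σ`, EVERY `t ≥ 0`, every `N` and every hard-sphere flow `Φ` of `N + 1` spheres of diameter
`ε_N = σ (N+1)^{-1/3}` on `𝕋³`, the `N`-uniform second-moment bound
`Σᵢ E[Kᵢ(t)²] ≤ C (1 + t)² (N+1)^{5/3}` under the local Gibbs law, where `Kᵢ(t)` is the number of times
in `[0, t]` at which particle `i` touches another particle.  This file records that it is a STRENGTHENING of
the support item `CollisionTightness` of route `JParityClosure` (tightness, uniformly in `N`, of the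
normalised collision count `ε_N (N+1)⁻¹ #{collision times in [0, τ]}` under the same laws; prover verdict
`open-problem`, 2026-08-16):

* `ncard_iUnion_le_sum` — `ncard` is subadditive over finite indexed unions;
* `numCollisions_le_sum_ncard` — PATHWISE: on a hard-sphere trajectory every collision time is a contact
  time of some particle, so `#{collision times in [0, t]} ≤ Σᵢ Kᵢ(t)`;
* `sq_numCollisions_le` — hence, by Cauchy–Schwarz in `ℕ`, `#{collision times in [0,t]}² ≤ (N+1) Σᵢ Kᵢ(t)²`
  (cast to `ℝ≥0∞`);
* `collisionTightness_of_collisionMoments` — `CollisionMoments → CollisionTightness`: the count, extended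
  by `0` off the good set, is measurable (`measurable_indicator_numCollisions`), the complement of the good
  set is null for the local Gibbs law (`≪` Liouville), and Markov's inequality on the squared count gives
  `P_N{K < ε_N (N+1)⁻¹ #collisions} ≤ C (1+τ)² σ² / K²` for every `N` (the powers of `N + 1` cancel
  exactly: `(N+1) · (N+1)^{5/3} · ε_N² / (N+1)² = σ²`), so `K = √(C (1+τ)² σ² / δ) + 1`, `N₀ = 0` does it.

Consequence recorded on the item: `CollisionMoments` is at least as hard as the open item 13085 (whose
open part is the passage from the flow-invariant homogeneous Gibbs law to non-constant local Gibbs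
profiles); in addition it asks second (not first) moments and uniformity over all `t ≥ 0`.

References: I. Gallagher, L. Saint-Raymond, B. Texier, *From Newton to Boltzmann* (2013), Prop. 4.1.1;
C. Cercignani, R. Illner, M. Pulvirenti, *The Mathematical Theory of Dilute Gases* (1994), App. 4.A.
-/

noncomputable section

open MeasureTheory Set Filter Topology
open scoped ENNReal BigOperators

namespace Summit.AtomisticToContinuum.HydrodynamicLimit.Theorems.CollisionMoments

open Literature.Analysis.FluidPDE Literature.MathematicalPhysics.KineticTheory

/-! ### Counting: collision times versus per-particle contact times -/

/-- `ncard` is subadditive over finite indexed unions (with the junk value `0` for infinite sets this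
holds unconditionally, as `Set.ncard_union_le` does). [folklore] -/
theorem ncard_iUnion_le_sum {ι α : Type*} [Fintype ι] (t : ι → Set α) :
    (⋃ i, t i).ncard ≤ ∑ i, (t i).ncard := by
  classical
  have h : ∀ s : Finset ι, (⋃ i ∈ s, t i).ncard ≤ ∑ i ∈ s, (t i).ncard := by
    intro s
    induction s using Finset.induction_on with
    | empty => simp
    | insert a s ha ih =>
      rw [Finset.set_biUnion_insert, Finset.sum_insert ha]
      exact (Set.ncard_union_le _ _).trans (Nat.add_le_add_left ih _)
  simpa using h Finset.univ

/-- **Pathwise: the collision count is dominated by the sum of the per-particle contact counts.** On a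
hard-sphere trajectory `γ` (locally finitely many collision times) and for every horizon `t`,
`#{collision times in [0, t]} ≤ Σᵢ #{τ ∈ [0, t] | particle i touches some j ≠ i at time τ}`: every
collision time is, by definition, a contact time of some ordered pair. [folklore] -/
theorem numCollisions_le_sum_ncard {d X : Type*} [Fintype d] [TopologicalSpace X]
    {G : Geometry d X} {ε : ℝ} {n : ℕ} {γ : ℝ → Config n d X} (hγ : IsHardSphereTrajectory G ε n γ)
    (t : ℝ) :
    numCollisions G ε γ 0 t ≤
      ∑ i : Fin n, Set.ncard {τ : ℝ | τ ∈ Icc 0 t ∧ ∃ j : Fin n, j ≠ i ∧ γ τ ∈ contactSet G n ε i j} := by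
  have hsub : collisionTimes G ε γ ∩ Icc 0 t ⊆
      ⋃ i : Fin n, {τ : ℝ | τ ∈ Icc 0 t ∧ ∃ j : Fin n, j ≠ i ∧ γ τ ∈ contactSet G n ε i j} := by
    rintro τ ⟨⟨i, j, hij, hc⟩, hτ⟩
    exact Set.mem_iUnion.2 ⟨i, hτ, j, hij.symm, hc⟩
  have hfin : (⋃ i : Fin n,
      {τ : ℝ | τ ∈ Icc 0 t ∧ ∃ j : Fin n, j ≠ i ∧ γ τ ∈ contactSet G n ε i j}).Finite := by
    refine Set.finite_iUnion fun i => (hγ.locFinite 0 t).subset ?_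
    rintro τ ⟨hτ, j, hji, hc⟩
    exact ⟨⟨i, j, fun h => hji h.symm, hc⟩, hτ⟩
  calc numCollisions G ε γ 0 t = (collisionTimes G ε γ ∩ Icc 0 t).ncard := rfl
    _ ≤ (⋃ i : Fin n,
          {τ : ℝ | τ ∈ Icc 0 t ∧ ∃ j : Fin n, j ≠ i ∧ γ τ ∈ contactSet G n ε i j}).ncard :=
        Set.ncard_le_ncard hsub hfin
    _ ≤ _ := ncard_iUnion_le_sum _

/-- **Cauchy–Schwarz for the count**: on a hard-sphere trajectory,
`#{collision times in [0, t]}² ≤ (number of particles) · Σᵢ Kᵢ(t)²` in `ℝ≥0∞`, where `Kᵢ(t)` is the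
per-particle contact count of `numCollisions_le_sum_ncard`. [folklore] -/
theorem sq_numCollisions_le {d X : Type*} [Fintype d] [TopologicalSpace X]
    {G : Geometry d X} {ε : ℝ} {n : ℕ} {γ : ℝ → Config n d X} (hγ : IsHardSphereTrajectory G ε n γ)
    (t : ℝ) :
    ((numCollisions G ε γ 0 t : ℕ) : ℝ≥0∞) ^ 2 ≤
      (n : ℝ≥0∞) * ∑ i : Fin n, ((Set.ncard {τ : ℝ | τ ∈ Icc 0 t ∧ ∃ j : Fin n, j ≠ i ∧
        γ τ ∈ contactSet G n ε i j} : ℕ) : ℝ≥0∞) ^ 2 := by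
  set K : Fin n → ℕ := fun i => Set.ncard {τ : ℝ | τ ∈ Icc 0 t ∧ ∃ j : Fin n, j ≠ i ∧
    γ τ ∈ contactSet G n ε i j} with hK
  have h1 : numCollisions G ε γ 0 t ≤ ∑ i, K i := numCollisions_le_sum_ncard hγ t
  have h2 : (∑ i, K i) ^ 2 ≤ n * ∑ i, K i ^ 2 := by
    simpa using (sq_sum_le_card_mul_sum_sq (s := (Finset.univ : Finset (Fin n))) (f := K))
  have h3 : numCollisions G ε γ 0 t ^ 2 ≤ n * ∑ i, K i ^ 2 :=
    (Nat.pow_le_pow_left h1 2).trans h2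
  calc ((numCollisions G ε γ 0 t : ℕ) : ℝ≥0∞) ^ 2 = ((numCollisions G ε γ 0 t ^ 2 : ℕ) : ℝ≥0∞) := by
        push_cast; rfl
    _ ≤ ((n * ∑ i, K i ^ 2 : ℕ) : ℝ≥0∞) := by exact_mod_cast h3
    _ = (n : ℝ≥0∞) * ∑ i : Fin n, ((K i : ℕ) : ℝ≥0∞) ^ 2 := by push_cast; rfl

/-! ### The bridge -/

/-- The scaling identity behind the bridge: `(N+1) · (N+1)^{5/3} · ε_N² = σ² (N+1)²` for
`ε_N = σ (N+1)^{-1/3}`. [folklore] -/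
theorem succ_mul_rpow_mul_hsDiameter_sq (σ : ℝ) (N : ℕ) :
    ((N : ℝ) + 1) * ((N : ℝ) + 1) ^ (5 / 3 : ℝ) * hsDiameter σ N ^ 2 = σ ^ 2 * ((N : ℝ) + 1) ^ 2 := by
  have hN : (0 : ℝ) < (N : ℝ) + 1 := by positivity
  have hcast : (((N + 1 : ℕ) : ℝ)) = (N : ℝ) + 1 := by push_cast; ring
  rw [hsDiameter, hcast, mul_pow, ← Real.rpow_natCast (((N : ℝ) + 1) ^ (-(1 / 3 : ℝ))) 2,
    ← Real.rpow_mul hN.le]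
  have h : ((N : ℝ) + 1) * ((N : ℝ) + 1) ^ (5 / 3 : ℝ) * ((N : ℝ) + 1) ^ (-(1 / 3 : ℝ) * (2 : ℕ)) =
      ((N : ℝ) + 1) ^ 2 := by
    rw [← Real.rpow_one ((N : ℝ) + 1), ← Real.rpow_mul hN.le, ← Real.rpow_mul hN.le,
      ← Real.rpow_add hN, ← Real.rpow_add hN, ← Real.rpow_natCast (((N : ℝ) + 1) ^ (1 : ℝ)) 2,
      ← Real.rpow_mul hN.le]
    norm_num
  calc ((N : ℝ) + 1) * ((N : ℝ) + 1) ^ (5 / 3 : ℝ) * (σ ^ 2 * ((N : ℝ) + 1) ^ (-(1 / 3 : ℝ) * (2 : ℕ)))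
        = σ ^ 2 * (((N : ℝ) + 1) * ((N : ℝ) + 1) ^ (5 / 3 : ℝ) *
            ((N : ℝ) + 1) ^ (-(1 / 3 : ℝ) * (2 : ℕ))) := by ring
    _ = σ ^ 2 * ((N : ℝ) + 1) ^ 2 := by rw [h]

/-- **`CollisionMoments` implies `CollisionTightness`.** If for every continuous local-Gibbs profile and
all small `σ` there is `C` with `Σᵢ E[Kᵢ(t)²] ≤ C (1+t)² (N+1)^{5/3}` for all `t ≥ 0`, `N`, `Φ`
(`UGibbsSRBRigidity.CollisionMoments`, stmt-AtomisticToContinuum-9393), then the normalised collision count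
`ε_N (N+1)⁻¹ #{collision times in [0, τ]}` is tight uniformly in `N` under the local Gibbs laws
(`JParityClosure.CollisionTightness`, stmt-AtomisticToContinuum-13085), with `σ₀' = min σ₀ ½`,
`K = √(max C 0 · (1+τ)² σ² / δ) + 1` and `N₀ = 0`: on the good set
`#collisions² ≤ (N+1) Σᵢ Kᵢ²` (`sq_numCollisions_le`), the good-set-extended count is measurable
(`measurable_indicator_numCollisions`), the bad set is null for the local Gibbs law, and Markov's
inequality gives `P_N{K < ε_N (N+1)⁻¹ #collisions} ≤ (N+1) C (1+τ)² (N+1)^{5/3} ε_N² / (K² (N+1)²) = C (1+τ)² σ² / K² ≤ δ`.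
[folklore] -/
theorem collisionTightness_of_collisionMoments
    (h : _root_.Summit.AtomisticToContinuum.HydrodynamicLimit.Theses.UGibbsSRBRigidity.CollisionMoments) :
    _root_.Summit.AtomisticToContinuum.HydrodynamicLimit.Theses.JParityClosure.CollisionTightness := by
  intro a₀ θ₀ u₀ ha hθ hu ha0 hθ0
  obtain ⟨σ₀, hσ₀, H⟩ := h a₀ θ₀ u₀ ha hθ hu ha0 hθ0
  refine ⟨min σ₀ 2⁻¹, lt_min hσ₀ (by norm_num), fun σ hσ hσlt Φ τ hτ δ hδ => ?_⟩
  have hσ₁ : σ < σ₀ := lt_of_lt_of_le hσlt (min_le_left _ _)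
  have hσ₂ : σ < 2⁻¹ := lt_of_lt_of_le hσlt (min_le_right _ _)
  obtain ⟨C, hC⟩ := H σ hσ hσ₁
  -- constants
  set C₀ : ℝ := max C 0 with hC₀
  have hC₀nn : 0 ≤ C₀ := le_max_right _ _
  set K : ℝ := Real.sqrt (C₀ * (1 + τ) ^ 2 * σ ^ 2 / δ) + 1 with hKdef
  have hKpos : 0 < K := by positivity
  have hKsq : C₀ * (1 + τ) ^ 2 * σ ^ 2 / δ ≤ K ^ 2 := by
    have hs := Real.sq_sqrt (show 0 ≤ C₀ * (1 + τ) ^ 2 * σ ^ 2 / δ by positivity)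
    nlinarith [Real.sqrt_nonneg (C₀ * (1 + τ) ^ 2 * σ ^ 2 / δ)]
  refine ⟨K, 0, fun N _ => ?_⟩
  -- abbreviations for particle number `N`
  set ε : ℝ := hsDiameter σ N with hεdef
  have hεpos : 0 < ε := hsDiameter_pos hσ N
  have hε2 : ε < 2⁻¹ := (hsDiameter_le hσ.le N).trans_lt hσ₂
  set n1 : ℝ := (N : ℝ) + 1 with hn1
  have hn1pos : 0 < n1 := by positivity
  set P := localGibbsLaw σ a₀ u₀ θ₀ N (Φ N) with hP
  set g : Config (N + 1) (Fin 3) T3 → ℝ≥0∞ := (Φ N).good.indicator fun z =>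
    (numCollisions (Torus.geometry (Fin 3)) ε (fun s => (Φ N).flow s z) 0 τ : ℝ≥0∞) with hg
  have hgm : Measurable g := measurable_indicator_numCollisions hε2 (Φ N) 0 τ
  -- the Markov level
  set m : ℝ := (K * n1 / ε) ^ 2 with hm
  have hmpos : 0 < m := by positivity
  set M : ℝ≥0∞ := ENNReal.ofReal m with hM
  have hM0 : M ≠ 0 := by rw [hM]; exact (ENNReal.ofReal_pos.2 hmpos).ne'
  have hMtop : M ≠ ∞ := ENNReal.ofReal_ne_top
  -- (1) event inclusion: off the good set, or the squared count exceeds the level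
  have hsub : {z : Config (N + 1) (Fin 3) T3 | K < hsDiameter σ N / (N + 1 : ℝ) *
      (numCollisions (Torus.geometry (Fin 3)) (hsDiameter σ N) (fun s => (Φ N).flow s z) 0 τ : ℝ)} ⊆
      (Φ N).goodᶜ ∪ {z | M ≤ g z ^ 2} := by
    intro z hz
    by_cases hgood : z ∈ (Φ N).good
    · refine Or.inr ?_
      simp only [mem_setOf_eq] at hz ⊢
      set c : ℕ := numCollisions (Torus.geometry (Fin 3)) (hsDiameter σ N) (fun s => (Φ N).flow s z) 0 τ
        with hc
      have hgz : g z = (c : ℝ≥0∞) := by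
        rw [hg, indicator_of_mem hgood]
      -- `K < ε/(N+1) · c` ⇒ `K (N+1)/ε < c` ⇒ `m = (K(N+1)/ε)² ≤ c²`
      have h1 : K * n1 / ε < c := by
        rw [div_lt_iff₀ hεpos]
        have := hz
        rw [← hεdef, div_mul_eq_mul_div, lt_div_iff₀ hn1pos] at this
        linarith
      have h2 : m ≤ (c : ℝ) ^ 2 := by
        rw [hm]
        exact pow_le_pow_left₀ (by positivity) h1.le 2
      rw [hgz, hM]
      calc ENNReal.ofReal m ≤ ENNReal.ofReal ((c : ℝ) ^ 2) := ENNReal.ofReal_le_ofReal h2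
        _ = (c : ℝ≥0∞) ^ 2 := by
            rw [ENNReal.ofReal_pow (Nat.cast_nonneg _), ENNReal.ofReal_natCast]
    · exact Or.inl hgood
  -- (2) the bad set is null for the local Gibbs law
  have hgood0 : P (Φ N).goodᶜ = 0 := by
    rw [hP, localGibbsLaw_eq]
    exact localGibbsMeasure_absolutelyContinuous σ _ _ _ N (Φ N) (Φ N).measure_compl_good
  -- (3) the squared count is dominated by `(N+1) Σᵢ Kᵢ²` pointwise
  have hdom : ∀ z, g z ^ 2 ≤ ((N + 1 : ℕ) : ℝ≥0∞) * ∑ i : Fin (N + 1),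
      ((Set.ncard {τ' : ℝ | τ' ∈ Set.Icc 0 τ ∧ ∃ j : Fin (N + 1), j ≠ i ∧ (Φ N).flow τ' z ∈
        contactSet (Torus.geometry (Fin 3)) (N + 1) (hsDiameter σ N) i j} : ENNReal)) ^ 2 := by
    intro z
    by_cases hgood : z ∈ (Φ N).good
    · rw [hg, indicator_of_mem hgood]
      exact sq_numCollisions_le ((Φ N).isTrajectory z hgood) τ
    · rw [hg, indicator_of_notMem hgood]
      simp
  -- (4) Markov + the moment bound
  have hint : ∫⁻ z, g z ^ 2 ∂P ≤ ENNReal.ofReal (n1 * (C₀ * (1 + τ) ^ 2 * n1 ^ (5 / 3 : ℝ))) := by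
    calc ∫⁻ z, g z ^ 2 ∂P ≤ ∫⁻ z, ((N + 1 : ℕ) : ℝ≥0∞) * ∑ i : Fin (N + 1),
          ((Set.ncard {τ' : ℝ | τ' ∈ Set.Icc 0 τ ∧ ∃ j : Fin (N + 1), j ≠ i ∧ (Φ N).flow τ' z ∈
            contactSet (Torus.geometry (Fin 3)) (N + 1) (hsDiameter σ N) i j} : ENNReal)) ^ 2 ∂P :=
          lintegral_mono hdom
      _ = ((N + 1 : ℕ) : ℝ≥0∞) * ∫⁻ z, ∑ i : Fin (N + 1),
          ((Set.ncard {τ' : ℝ | τ' ∈ Set.Icc 0 τ ∧ ∃ j : Fin (N + 1), j ≠ i ∧ (Φ N).flow τ' z ∈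
            contactSet (Torus.geometry (Fin 3)) (N + 1) (hsDiameter σ N) i j} : ENNReal)) ^ 2 ∂P :=
          lintegral_const_mul' _ _ (ENNReal.natCast_ne_top _)
      _ ≤ ((N + 1 : ℕ) : ℝ≥0∞) * ENNReal.ofReal (C * (1 + τ) ^ 2 * ((N : ℝ) + 1) ^ (5 / 3 : ℝ)) := by
          gcongr
          exact hC τ hτ.le N (Φ N)
      _ ≤ ((N + 1 : ℕ) : ℝ≥0∞) * ENNReal.ofReal (C₀ * (1 + τ) ^ 2 * n1 ^ (5 / 3 : ℝ)) := by
          gcongr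
          exact le_max_left _ _
      _ = ENNReal.ofReal (n1 * (C₀ * (1 + τ) ^ 2 * n1 ^ (5 / 3 : ℝ))) := by
          rw [ENNReal.ofReal_mul hn1pos.le, hn1]
          congr 1
          rw [← ENNReal.ofReal_natCast]
          push_cast
          rfl
  have hmarkov : P {z | M ≤ g z ^ 2} ≤ (∫⁻ z, g z ^ 2 ∂P) / M :=
    meas_ge_le_lintegral_div (hgm.pow_const 2).aemeasurable hM0 hMtop
  -- (5) the arithmetic: `(N+1) C₀ (1+τ)² (N+1)^{5/3} / (K (N+1)/ε)² = C₀ (1+τ)² σ² / K² ≤ δ`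
  have harith : n1 * (C₀ * (1 + τ) ^ 2 * n1 ^ (5 / 3 : ℝ)) / m ≤ δ := by
    rw [div_le_iff₀ hmpos, hm, div_pow, mul_pow]
    rw [mul_div_assoc', le_div_iff₀ (by positivity)]
    have hid := succ_mul_rpow_mul_hsDiameter_sq σ N
    rw [← hεdef, ← hn1] at hid
    -- goal: n1 * (C₀ (1+τ)² n1^{5/3}) * ε² ≤ δ * (K² n1²)
    have hK2 : C₀ * (1 + τ) ^ 2 * σ ^ 2 ≤ δ * K ^ 2 := by
      have hK1 := (div_le_iff₀ hδ).1 hKsq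
      linarith [hK1]
    calc n1 * (C₀ * (1 + τ) ^ 2 * n1 ^ (5 / 3 : ℝ)) * ε ^ 2
        = C₀ * (1 + τ) ^ 2 * (n1 * n1 ^ (5 / 3 : ℝ) * ε ^ 2) := by ring
      _ = C₀ * (1 + τ) ^ 2 * σ ^ 2 * n1 ^ 2 := by rw [hid]; ring
      _ ≤ δ * K ^ 2 * n1 ^ 2 := by gcongr
      _ = δ * (K ^ 2 * n1 ^ 2) := by ring
  calc P {z | K < hsDiameter σ N / (N + 1 : ℝ) *
        (numCollisions (Torus.geometry (Fin 3)) (hsDiameter σ N) (fun s => (Φ N).flow s z) 0 τ : ℝ)}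
      ≤ P ((Φ N).goodᶜ ∪ {z | M ≤ g z ^ 2}) := measure_mono hsub
    _ ≤ P (Φ N).goodᶜ + P {z | M ≤ g z ^ 2} := measure_union_le _ _
    _ = P {z | M ≤ g z ^ 2} := by rw [hgood0, zero_add]
    _ ≤ (∫⁻ z, g z ^ 2 ∂P) / M := hmarkov
    _ ≤ ENNReal.ofReal (n1 * (C₀ * (1 + τ) ^ 2 * n1 ^ (5 / 3 : ℝ))) / M := by gcongr
    _ = ENNReal.ofReal (n1 * (C₀ * (1 + τ) ^ 2 * n1 ^ (5 / 3 : ℝ)) / m) := by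
        rw [hM, ENNReal.ofReal_div_of_pos hmpos]
    _ ≤ ENNReal.ofReal δ := ENNReal.ofReal_le_ofReal harith

end Summit.AtomisticToContinuum.HydrodynamicLimit.Theorems.CollisionMoments

end
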